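import Summits.SmoothPoincare4.SmoothPoincare4.Theorems.WeakReductionDescentWeakReductionReducesStubLoopFromGenusThreeAux1
import Literature.Topology.FourManifolds.TrisectionEulerProofs
import Literature.Topology.FourManifolds.TrisectionSectorCollars
import Literature.Topology.FourManifolds.SurfaceCappingOrientation
import Literature.Topology.FourManifolds.ImmersionOrientation
import Literature.AlgebraicTopology.SingularHomology.CompactManifoldFiniteness
import Literature.AlgebraicTopology.SingularHomology.FundamentalClassProofs

/-!
# Crux `WeakReductionReduces` (stmt-SmoothPoincare4-17908), line `loop_dichotomy`, stub L₃ —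
# auxiliary file 2: topology of the loop partner `X` (Euler characteristic of a GK-trisection in
# general; connectedness; orientability from the surgered manifold) — all PROVED

Stub L₃ (`stub_loopFromGenusThree`): a smooth homotopy `4`-sphere `M` obtained by surgery
(`Literature.Topology.FourManifolds.IsCircleSurgery`) on a smoothly embedded loop `ℓ` in a closed
smooth `X` carrying a GK-trisection of genus `g′ ≤ 3` is diffeomorphic to `S⁴`.  Its reduction to
named published facts (auxiliary file 3) needs three unconditional facts about the loop partner
`X`, proved here:

* `relEuler_eq_of_isGKTrisection` (universe-polymorphic) and its registered `Type`-level form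
  `helper_gkTrisection_relEuler` — **Gay–Kirby 2016 Remark 2 / Meier–Schirmer–Zupan 2016
  Remark 3.12 in GENERAL: a closed smooth `4`-manifold with a `(g; k₀, k₁, k₂)`-GK-trisection has
  `χ(X) = 2 + g − (k₀ + k₁ + k₂)`**, `χ` being the tree's `relEuler ℤ ℤ X ∅`.  The tree proved the
  homotopy-sphere specialisation `g = Σ kᵢ`
  (`gkTrisection_genus_eq_sum_of_homotopyEquiv_sphere_holds`, `TrisectionEulerProofs.lean`); the
  proof here is the same inclusion–exclusion of the rational Čech Euler characteristic over the
  cover by the three sectors (tautness of the compact pieces, Morse equalities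
  `χ(Xᵢ) = 1 − kᵢ`, `χ(Hᵢⱼ) = 1 − g`, `χ(F) = 2 − 2g`), with `χ(X)` kept symbolic through the
  finite type of the homology of a closed manifold (`finite_singularHomology_of_compactSpace_holds`,
  `isZero_singularHomology_of_lt_holds`).
* `pathConnectedSpace_of_isGKTrisection` — a GK-trisected `4`-manifold is (path) connected.
* `isOrientable_of_isCircleSurgery` — if `M` is obtained from `X` by surgery on a circle and `M`
  is orientable, then `X` is orientable: `X` is covered by `X ∖ c` (an open subset of `M` via the
  gluing map) and the tube `ν(S¹ × ℝ³) ≅ S¹ × ℝ³ ↪ ℝ⁴` (standard tube `StdCircleSurgery.stdNbhd`),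
  both orientable by pull-back (`IsOrientable.of_isSmoothEmbedding`; the cross-model composition
  lemma `isSmoothEmbedding_comp_of_isOpen_range` of auxiliary file 1), meeting in the connected
  punctured tube, so the orientations glue (`IsOrientable.of_opens_cover_of_isPreconnected`).

## References

* D. Gay, R. Kirby, Geom. Topol. 20 (2016): Def. 1, Remark 2. [GayKirby2016]
* J. Meier, T. Schirmer, A. Zupan, Proc. AMS 144 (2016), arXiv:1507.06561: Remark 3.12.
  [MeierSchirmerZupan2016]
* A. Hatcher, *Algebraic Topology* (2002), Thm. 2.44, §3.3, App. A. [HatcherAT2002]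
* M. Hirsch, *Differential Topology* (1976), §4.4. [HirschDT1976]
-/

-- the registered namespace `Summit.SmoothPoincare4.SmoothPoincare4.Theorems…` repeats a component
set_option linter.dupNamespace false

noncomputable section

open scoped Manifold ContDiff Topology ContinuousMap
open Set Function
open Literature.Topology.FourManifolds
open Literature.AlgebraicTopology.SingularHomology Literature.AlgebraicTopology.Homotopy

namespace Summit.SmoothPoincare4.SmoothPoincare4.Theorems.WeakReductionReduces.LoopDichotomy

universe u

/-! ### Gay–Kirby's Remark 2 in general: `χ(X) = 2 + g − Σ kᵢ` (proved) -/

-- adapted from `gkTrisection_genus_eq_sum_of_homotopyEquiv_sphere_holds`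
-- (Literature/Topology/FourManifolds/TrisectionEulerProofs.lean, Part II): the same
-- inclusion–exclusion, with `χ(X)` kept symbolic.
/-- **Gay–Kirby 2016, Remark 2 / Meier–Schirmer–Zupan 2016, Remark 3.12, GENERAL form, PROVED.**
A closed smooth `4`-manifold `X` with a `(g; k₀, k₁, k₂)`-trisection in the sense of
`IsGKTrisection` has Euler characteristic `χ(X) = 2 + g − (k₀ + k₁ + k₂)` (MSZ, Remark 3.12: "The
induced handle decomposition … yields `χ(X) = k₁ + k₂ + k₃ − g + 2`", printed with the sign of
`g − Σkᵢ` flipped; GK, Remark 2: `χ(X) = 2 + g − 3k`), the Euler characteristic being the tree's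
`relEuler ℤ ℤ X ∅`.  Proof: inclusion–exclusion of the rational Čech Euler characteristic over the
cover by the three sectors (`Cech.euler_union₃`), tautness of the compact pieces, the Morse
equalities `χ(Xᵢ) = 1 − kᵢ`, `χ(Hᵢⱼ) = 1 − g`, `χ(F) = 2 − 2g`, and `χ̌(X) = χ(X)` (finiteness of
the homology of a closed manifold, `finite_singularHomology_of_compactSpace_holds`,
`isZero_singularHomology_of_lt_holds`); word for word the tree's proof of the homotopy-sphere case
with `χ(X)` kept symbolic.
[cite: GayKirby2016, Remark 2] [cite: MeierSchirmerZupan2016, Remark 3.12] -/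
theorem relEuler_eq_of_isGKTrisection {X : Type u} [TopologicalSpace X] [T2Space X]
    [SecondCountableTopology X] [ChartedSpace (EuclideanSpace ℝ (Fin 4)) X] [IsManifold (𝓡 4) ∞ X]
    [CompactSpace X] {g : ℕ} {k : Fin 3 → ℕ} {S : Fin 3 → Set X} (hT : IsGKTrisection X g k S) :
    relEuler ℤ ℤ X ∅ = 2 + (g : ℤ) - (k 0 + k 1 + k 2 : ℕ) := by
  -- the rational coefficient object
  let Qu : ModuleCat.{u} ℚ := ModuleCat.of ℚ (ULift.{u} ℚ)
  -- `X` embeds in some `ℝᵐ` as a neighbourhood retract (compact manifolds are ENRs)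
  obtain ⟨m, ι, hιc⟩ :=
    Literature.Geometry.Manifold.exists_isClosedEmbedding_pi_of_compactSpace
      (EuclideanSpace ℝ (Fin 4)) (M := X)
  have hι : Topology.IsEmbedding ι := hιc.isEmbedding
  have hX : Literature.AlgebraicTopology.Homotopy.IsNeighbourhoodRetract (range ι) :=
    Literature.AlgebraicTopology.Homotopy.isNeighbourhoodRetract_range_of_compactSpace
      Literature.AlgebraicTopology.Homotopy.isNeighbourhoodRetract_of_locallyContractibleSpace_holds
      (EuclideanSpace ℝ (Fin 4)) hι
  obtain ⟨hcov, hsec, hpair⟩ := hT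
  have hKc : ∀ i, IsCompact (S i) := fun i =>
    IsGKTrisection.isCompact (X := X) ⟨hcov, hsec, hpair⟩ i
  -- (a) the sectors: `χ̌(S i) = χ(W_i) = 1 - k i`
  have hSec : ∀ i, Cech.FinCech ℚ Qu (S i) 5 ∧ Cech.euler ℚ Qu (S i) = 1 - (k i : ℤ) := by
    intro i
    obtain ⟨W, _, _, f, hM, hW, -, hh, hf, hrange, -⟩ := hsec i
    haveI := hM; haveI := hW
    haveI : T2Space W := hf.t2Space
    haveI : SecondCountableTopology W := hf.secondCountableTopology
    let φ : ↥(S i) ≃ₜ W := (hf.toHomeomorph.trans (Homeomorph.setCongr hrange)).symm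
    obtain ⟨hP, hPe⟩ := relEuler_of_handleCount hh
    obtain ⟨hF, hFe⟩ := finCech_and_euler_of_homeomorph hι hX (hKc i) φ
      (locallyContractibleSpace_of_chartedSpace_halfSpace 4 W) hP
    exact ⟨hF, hFe.trans hPe⟩
  -- (b) the double intersections and (c) the central surface
  have hPair : ∀ i j, i ≠ j →
      (Cech.FinCech ℚ Qu (S i ∩ S j) 5 ∧ Cech.euler ℚ Qu (S i ∩ S j) = 1 - (g : ℤ)) ∧
      (Cech.FinCech ℚ Qu (⋂ l, S l) 5 ∧ Cech.euler ℚ Qu (⋂ l, S l) = 2 - 2 * (g : ℤ)) := by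
    intro i j hij
    obtain ⟨H, _, _, h, hM, hH, -, hh, hf, hrange, hbd⟩ := hpair i j hij
    haveI := hM; haveI := hH
    haveI : T2Space H := hf.isEmbedding.t2Space
    haveI : SecondCountableTopology H := hf.isEmbedding.secondCountableTopology
    have hKij : IsCompact (S i ∩ S j) := (hKc i).inter_right (hKc j).isClosed
    have hKI : IsCompact (⋂ l, S l) :=
      IsGKTrisection.isCompact_iInter (X := X) ⟨hcov, hsec, hpair⟩
    constructor
    · let φ : ↥(S i ∩ S j) ≃ₜ H :=
        (hf.isEmbedding.toHomeomorph.trans (Homeomorph.setCongr hrange)).symm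
      obtain ⟨hP, hPe⟩ := relEuler_of_handleCount hh
      obtain ⟨hF, hFe⟩ := finCech_and_euler_of_homeomorph hι hX hKij φ
        (locallyContractibleSpace_of_chartedSpace_halfSpace 3 H)
        (hP.mono (show 2 + 2 ≤ 5 by norm_num))
      exact ⟨hF, hFe.trans hPe⟩
    · let φ : ↥(⋂ l, S l) ≃ₜ ((𝓡∂ 3).boundary H) :=
        ((hf.isEmbedding.homeomorphImage ((𝓡∂ 3).boundary H)).trans
          (Homeomorph.setCongr hbd)).symm
      obtain ⟨hP, hPe⟩ := relEuler_boundary_of_handleCount hh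
      obtain ⟨hF, hFe⟩ := finCech_and_euler_of_homeomorph hι hX hKI φ
        (locallyContractibleSpace_of_chartedSpace (EuclideanSpace ℝ (Fin 2))
          (M := (𝓡∂ 3).boundary H)) (hP.mono (show 2 + 2 ≤ 5 by norm_num))
      refine ⟨hF, hFe.trans ?_⟩
      rw [hPe]
      ring
  -- (d) `X` itself: `χ̌(X) = χ(X)` (the homology of a closed manifold is of finite type)
  have hUniv : Cech.FinCech ℚ Qu (univ : Set X) 5 ∧
      Cech.euler ℚ Qu (univ : Set X) = relEuler ℤ ℤ X ∅ := by
    have hP : FinRelHomology ℤ ℤ X ∅ 5 :=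
      FinRelHomology.empty_of_absolute
        (fun j => finite_singularHomology_of_compactSpace_holds ℤ X 4 j)
        (fun _ hj => isZero_singularHomology_of_lt_holds ℤ ℤ X 4 (by omega))
    exact finCech_and_euler_of_homeomorph hι hX isCompact_univ (Homeomorph.Set.univ X)
      (locallyContractibleSpace_of_chartedSpace (EuclideanSpace ℝ (Fin 4)) (M := X)) hP
  -- inclusion–exclusion over the cover `X = S 0 ∪ S 1 ∪ S 2`
  have hU : S 0 ∪ S 1 ∪ S 2 = univ := union_eq_univ_of_iUnion_fin_three hcov
  have hI : (⋂ l, S l) = S 0 ∩ S 1 ∩ S 2 := iInter_fin_three S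
  obtain ⟨f₀₁, e₀₁⟩ := (hPair 0 1 (by decide)).1
  obtain ⟨f₀₂, e₀₂⟩ := (hPair 0 2 (by decide)).1
  obtain ⟨f₁₂, e₁₂⟩ := (hPair 1 2 (by decide)).1
  obtain ⟨fI, eI⟩ := (hPair 0 1 (by decide)).2
  rw [hI] at fI eI
  obtain ⟨-, hχ⟩ := Cech.euler_union₃ (hKc 0) (hKc 1) (hKc 2) (hSec 0).1 (hSec 1).1 (hSec 2).1
    f₀₁ f₀₂ f₁₂ fI
  rw [hU, hUniv.2, (hSec 0).2, (hSec 1).2, (hSec 2).2, e₀₁, e₀₂, e₁₂, eI] at hχ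
  push_cast
  linarith

/-- **Gay–Kirby's Remark 2 in general (registered helper, `Type`-level form of
`relEuler_eq_of_isGKTrisection`)**: a closed smooth `4`-manifold `X` with a
`(g; k₀, k₁, k₂)`-GK-trisection has `χ(X) = 2 + g − (k₀ + k₁ + k₂)`.
[cite: GayKirby2016, Remark 2] [cite: MeierSchirmerZupan2016, Remark 3.12] -/
theorem helper_gkTrisection_relEuler :
    ∀ (X : Type) [TopologicalSpace X] [T2Space X] [SecondCountableTopology X] [ChartedSpace (EuclideanSpace ℝ (Fin 4)) X] [IsManifold (𝓡 4) ((⊤ : ℕ∞) : WithTop ℕ∞) X] [CompactSpace X] (g : ℕ) (k : Fin 3 → ℕ) (S : Fin 3 → Set X), Literature.Topology.FourManifolds.IsGKTrisection X g k S → Literature.AlgebraicTopology.SingularHomology.relEuler ℤ ℤ X ∅ = 2 + (g : ℤ) - ((k 0 + k 1 + k 2 : ℕ) : ℤ) :=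
  fun _ _ _ _ _ _ _ _ _ _ hT ↦ relEuler_eq_of_isGKTrisection hT

/-! ### Topology of the loop partner `X`: connected (trisection) and orientable (surgery) -/

/-- A GK-trisected `4`-manifold is path connected: the sectors are path connected, any two of
them meet (along a handlebody containing the non-empty central surface), and they cover.
[cite: GayKirby2016, Def. 1] -/
theorem pathConnectedSpace_of_isGKTrisection {X : Type u} [TopologicalSpace X] [T2Space X]
    [ChartedSpace (EuclideanSpace ℝ (Fin 4)) X] {g : ℕ} {k : Fin 3 → ℕ} {S : Fin 3 → Set X}
    (hT : IsGKTrisection X g k S) : PathConnectedSpace X := by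
  obtain ⟨x, hx⟩ := hT.nonempty_iInter
  have hx' := mem_iInter.1 hx
  have h012 : IsPathConnected (S 0 ∪ S 1 ∪ S 2) :=
    (hT.isPathConnected_union 0 1).union (hT.isPathConnected_sector 2)
      ⟨x, Or.inl (hx' 0), hx' 2⟩
  rw [union_eq_univ_of_iUnion_fin_three hT.iUnion_eq] at h012
  exact pathConnectedSpace_iff_univ.mpr h012

/-- **Surgery on a circle preserves orientability (backwards): if `M = X_c` is orientable then so
is `X`.**  `X` is covered by the complement `X ∖ c` — which embeds openly in `M` (the gluing map
`jA`), so inherits an orientation (`IsOrientable.of_isSmoothEmbedding`) — and by the tube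
`ν(S¹ × ℝ³)`, an open set diffeomorphic to `S¹ × ℝ³`, hence to an open subset of `ℝ⁴` (the
standard tube `StdCircleSurgery.stdTube`), hence orientable; the overlap `ν(S¹ × (ℝ³ ∖ 0))` is
connected, so the two orientations glue after possibly reversing one
(`IsOrientable.of_opens_cover_of_isPreconnected`; Hirsch 1976, §4.4).
[cite: HirschDT1976, Ch. 4 §4] -/
theorem isOrientable_of_isCircleSurgery {X : Type} [TopologicalSpace X] [T2Space X]
    [ChartedSpace (EuclideanSpace ℝ (Fin 4)) X] [IsManifold (𝓡 4) ∞ X]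
    {c : (Metric.sphere (0 : EuclideanSpace ℝ (Fin 2)) 1) → X} {M : Type} [TopologicalSpace M]
    [ChartedSpace (EuclideanSpace ℝ (Fin 4)) M]
    [IsManifold (𝓡 4) ∞ M] (hM : IsOrientable (𝓡 4) M) (h : IsCircleSurgery (𝓡 4) (𝓡 4) X M c) :
    IsOrientable (𝓡 4) X := by
  haveI := Fact.mk (@finrank_euclideanSpace_fin ℝ _ 2)
  obtain ⟨ν, jA, jB, hA, hAo, -, -, -, -⟩ := h
  -- the two open pieces
  let U : TopologicalSpace.Opens X := ν.complement
  let V : TopologicalSpace.Opens X := rangeOpens ν.toFun ν.isOpen_range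
  have hUo : IsOrientable (𝓡 4) ↥U := IsOrientable.of_isSmoothEmbedding hA hM
  have hVo : IsOrientable (𝓡 4) ↥V := by
    haveI : Nonempty ↥V := ⟨rangeDiffeomorph ν.isSmoothEmbedding ν.isOpen_range
      (Classical.arbitrary _, 0)⟩
    let ρ := (rangeDiffeomorph ν.isSmoothEmbedding ν.isOpen_range).symm
    have hr : range (ρ : ↥V → _) = univ :=
      Set.eq_univ_of_forall fun q ↦ ⟨ρ.symm q, ρ.apply_symm_apply q⟩
    have hemb : Manifold.IsSmoothEmbedding (𝓡 4) (𝓡 4) ∞ (StdCircleSurgery.stdNbhd.toFun ∘ ρ) :=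
      isSmoothEmbedding_comp_of_isOpen_range
        (isSmoothEmbedding_diffeomorph_of_boundaryless ρ StdCircleSurgery.tubeLin.symm)
        (by rw [hr]; exact isOpen_univ) StdCircleSurgery.stdNbhd.isSmoothEmbedding
        StdCircleSurgery.stdNbhd.isOpen_range (ContinuousLinearEquiv.refl ℝ _)
    exact IsOrientable.of_isSmoothEmbedding hemb (isOrientable_euclideanSpace 4)
  -- they cover, and meet in the connected punctured tube `ν (S¹ × (ℝ³ ∖ 0))`
  have hcover : ∀ x, x ∈ U ∨ x ∈ V := by
    intro x
    by_cases hx : x ∈ range c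
    · obtain ⟨u, rfl⟩ := hx
      exact Or.inr ⟨(u, 0), ν.apply_zero u⟩
    · exact Or.inl hx
  have hUV : ((U : Set X) ∩ V) = ν.toFun '' {q | q.2 ≠ 0} := by
    ext x
    simp only [Set.mem_inter_iff, SetLike.mem_coe, Set.mem_image, Set.mem_setOf_eq]
    constructor
    · rintro ⟨hxc, ⟨q, rfl⟩⟩
      refine ⟨q, fun hq ↦ hxc ?_, rfl⟩
      obtain ⟨u, w⟩ := q
      simp only at hq
      subst hq
      exact ⟨u, (ν.apply_zero u).symm⟩
    · rintro ⟨⟨u, w⟩, hq, rfl⟩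
      exact ⟨fun hmem ↦ hq ((apply_mem_range_iff ν).1 hmem), ⟨(u, w), rfl⟩⟩
  have hconn : IsPreconnected ((U : Set X) ∩ V) := by
    rw [hUV]
    have hrank2 : 1 < Module.rank ℝ (EuclideanSpace ℝ (Fin 2)) := by
      rw [← Module.finrank_eq_rank, finrank_euclideanSpace_fin]
      exact Nat.one_lt_cast.mpr (by norm_num)
    have hrank3 : 1 < Module.rank ℝ (EuclideanSpace ℝ (Fin 3)) := by
      rw [← Module.finrank_eq_rank, finrank_euclideanSpace_fin]
      exact Nat.one_lt_cast.mpr (by norm_num)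
    haveI : PreconnectedSpace (Metric.sphere (0 : EuclideanSpace ℝ (Fin 2)) 1) :=
      isPreconnected_iff_preconnectedSpace.mp
      (isConnected_sphere hrank2 (0 : EuclideanSpace ℝ (Fin 2)) zero_le_one).isPreconnected
    have hset : {q : (Metric.sphere (0 : EuclideanSpace ℝ (Fin 2)) 1) × EuclideanSpace ℝ (Fin 3) | q.2 ≠ 0} =
        (univ : Set (Metric.sphere (0 : EuclideanSpace ℝ (Fin 2)) 1)) ×ˢ
          ({0}ᶜ : Set (EuclideanSpace ℝ (Fin 3))) := by
      ext q; simp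
    rw [hset]
    exact (isPreconnected_univ.prod
      (isConnected_compl_singleton_of_one_lt_rank hrank3 0).isPreconnected).image _
      ν.continuous.continuousOn
  exact IsOrientable.of_opens_cover_of_isPreconnected U V hcover hUo hVo hconn

end Summit.SmoothPoincare4.SmoothPoincare4.Theorems.WeakReductionReduces.LoopDichotomy

end
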